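import Literature.MathematicalPhysics.QuantumFieldTheory.Balaban1983to89.B13Term214

/-!
# `Balaban1983to89.B13Representation214` — T. Bałaban, *Renormalization group approach to lattice gauge field
theories. II. Cluster expansions*, Commun. Math. Phys. **116** (1988) 1–22 [Balaban1988RG2Cluster], pp. 14–15: the
sentence introducing (2.14) — *"To get a bound for H(Z) we consider a term in the sum over 𝐃, P. This term can be
written in the following form: (2.14)"* — PROVED for the typed objects: the `(𝐃, P)`-summand of the activity
`H(Z, Z₀)` of (2.8), with the Mayer expansion (2.1) and the decomposition (2.3) inserted under the Gaussian integrals,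
IS the display (2.14) (`B13Term214.term214` applied to `B13Term214.core214`)

statement-level skeleton of published theorems with citation tags; proofs where landed; nothing here is a claim about
the Yang–Mills mass gap

PDF held: `paper:balaban1988-cmp116-rg-ii-cluster` (journal page = PDF page + 0); pp. 12, 14, 15 read as images from
`run/shared/lean/pub/pub-balaban/b2b-balaban-ref1/pages/1988-cmp116-rg-II-cluster/1988-cmp116-rg-II-cluster-p012-x2.png`,
`…-p014-x2.png`, `…-p015-x2.png` (and the cell transcript `pub-balaban/b2b-balaban-b13/transcript-B13.md`).

CITATION HEADER (verbatim).  p. 12 [PDF 12], (2.1): *"`∫dμ_{C^{(k)}}(B) χ_k exp[Σ_{Y∈𝐃_k} 𝐕_k(Y, B)] = Σ_{𝐃⊂𝐃_k}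
Π_{Y∈𝐃} ∫₀¹ dt(Y) ∫dμ_{C^{(k)}}(B) χ_k exp[Σ_{Y∈𝐃} t(Y)𝐕_k(Y, B)] Π_{Y∈𝐃} 𝐕_k(Y, B)`"*; (2.3): *"`χ_k = χ_{k,Y₀}
χ_{k,Y₀ᶜ} = Σ_{P⊂Y₀^{c*}} (−1)^{|P|} χ_{k,Y₀} χᶜ_{k,P}`"*.  p. 14 [PDF 14], (2.8): *"`∫dμ₀(X)G(Z₀, X, C^{(k)}(Z₀),
(C^{(k)})^{1/2}, Δ_k) = Σ_Z Π_{Δ⊂Z∖Z̃′₀} ∫₀¹ ds(Δ) ∂/∂s(Δ) ∫dμ₀(X)G(Z₀, X, C^{(k)}(Z₀, s(Z)), (C^{(k)})^{1/2}(s(Z)),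
Δ_k(s(Z))) = Σ_Z H(Z, Z₀)`"*.  p. 15 [PDF 15]: *"To get a bound for H(Z) we consider a term in the sum over 𝐃, P.
This term can be written in the following form:*
`Π_{Δ⊂Z∖Z′₀} ∫₀¹ ds(Δ) (1/2πi) ∫ dσ(Δ)/(σ(Δ) − s(Δ))² Π_{Y∈𝐃} ∫₀¹ dt(Y) (1/2πi) ∫ dτ(Y)/(τ(Y) − t(Y))²`
`  · ∫dμ₀(X)|_Z exp(−½⟨Γ_k(Z₀,σ(Z))X, C^{(k)}(Z₀,σ(Z))Γ_k(Z₀,σ(Z))X⟩) · ∫dμ_{C^{(k)}(Z₀,σ(Z))}(B) exp(−⟨B, Γ_k(Z₀,σ(Z))X⟩)`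
`  · (−1)^{|P|} χ_{k,Y₀}(B) χᶜ_{k,P}(B) exp[Σ_{Y∈𝐃} τ(Y)𝐕_k(Y, B)],`  (2.14)
*… We consider it as an analytic function of (𝐔, 𝐉) in the space 𝐔ᶜ_{k+1}(X, α₀, α₁), and of the complex parameters
σ(Z), τ."*

WHAT IS REPRODUCED (unit `lit-balaban-r10` gen 9, B13 fold owner; SKELETON row `B13.Eq2.14` of
`HOME/lit-balaban-r10/ROWS-B13.md` — «typed (objects) · proved (Cauchy device)»; the gen-8 HANDOFF listed *"the
(2.14)-representation of H(Z) from (2.8)×(2.1) beyond `B13Term214.term214_eq_DopC`"* in the by-assertion residue of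
the kernel-checked chain (2.14) → (2.26)).  `B13Term214` PROVED that the printed Cauchy operators of (2.14) equal the
iterated DIFFERENCE operators in `σ` and `τ` (`term214_eq_DopC`, under separate holomorphy `SepHolOn`), and TYPED the
integrand (`core214 A Γ F σ τ = ∫dμ₀(X)|_Z (lines 2–4)` with `F τ` the last line).  THIS FILE closes the bookkeeping
between that and the activity of (2.8):
* §1 `cornerC_ofReal`, `DopC_ofReal` — the complex corner differences of `B13Term214` at a REAL base point are the
  real corner differences `B13MayerDecoupling.Dop` of (1.9)/(2.8) (so `B13Sect2Statements.H28`, the summand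
  `H(Z, Z₀) = D_{Z∖Z′₀}Φ|_{s(σ₀)=0}` of (2.8), is a `DopC`); `DopC_congr`, `cornerC_mem` (plumbing).
* §2 the last line at the `t`-corners: `DopC_cexp_sum` — `D^τ_{𝐃} exp[Σ_{Y∈𝐃} τ(Y)V_Y] = Π_{Y∈𝐃}(e^{V_Y} − 1)`, the
  `𝐃`-term of the Mayer expansion (2.1) (`B13MayerDecoupling.exp_sum_eq_sum_powerset_prod`: `e^{ΣV} = Σ_{𝐃}Π(e^{V}−1)`;
  the printed `Π∫₀¹dt(Y) e^{t𝐕}𝐕` is the same number, `B13MayerDecoupling.integral_exp_mul_eq`); `DopC_F214` — for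
  the printed last line `F(τ, B) = (−1)^{|P|}χ_{k,Y₀}(B)χᶜ_{k,P}(B)exp[Σ_{Y∈𝐃}τ(Y)𝐕_k(Y,B)]` (`B13Term214.F214`),
  `D^τ_{𝐃} F(·, B) = (−1)^{|P|}χ_{k,Y₀}(B)χᶜ_{k,P}(B)·Π_{Y∈𝐃}(e^{𝐕_k(Y,B)} − 1)` — the `(𝐃, P)`-term of (2.1)×(2.3);
  and `sum_DP_lastLine` — summed over `P ⊂ Y₀^{c*}` and `𝐃 ⊂ 𝐃_k` these give back `χ_k(B)·exp[Σ_{Y∈𝐃_k}𝐕_k(Y,B)]`,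
  the integrand of the left side of (2.1) ((2.3) = `B13MayerDecoupling.prod_one_sub_eq_sum_powerset`).
* §3 exchange of the finite corner sums with the Gaussian structure (linearity, GIVEN integrability of each corner
  term — needed for `∫Σ = Σ∫`): `cgaussMean_finset_sum`, `integrand214_finset_sum`, and `DopC_core214` —
  `D^τ_{𝐃}[∫dμ₀(X)|_Z (lines 2–4 with last line F(τ,·))] = ∫dμ₀(X)|_Z (lines 2–4 with last line D^τ_{𝐃}F(·, B))`.
* §4 **the representation**: `H28_eq_term214` — for operator families `A(σ) = C^{(k)}(Z₀,σ)⁻¹`, `Γ(σ) = Γ_k(Z₀,σ)`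
  and a `τ`-dependent last line `F`, IF `core214 A Γ F` is separately holomorphic in the `σ(Δ)` and in the `τ(Y)` on
  an open `U` containing the closed `r`-discs about `[0, 1]` (the printed *"analytic function … of the complex
  parameters σ(Z), τ"*) and the corner terms are integrable at the parameter points in `U`, THEN the (2.8)-summand
  `H28 Z′₀ σ₀ Φ s Z` of the function `Φ(s′) = ∫dμ₀(X)|_Z exp(−½⟨Γ(s′)X, A(s′)⁻¹Γ(s′)X⟩)∫dμ_{A(s′)⁻¹}(B)e^{−⟨B,Γ(s′)X⟩}
  [D^τ_{𝐃}F](B)` — lines 2–3 of (2.14) at the REAL parameters `s′` with the `(𝐃,P)`-term of (2.1)×(2.3) as last line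
  — EQUALS the display (2.14), `B13Term214.term214 r (Z∖Z′₀) 𝐃 (core214 A Γ F) s|_{s(σ₀)=0} τ₀` (and
  `H28_eq_term214_F214`: the same with the printed last line `B13Term214.F214` and its corner product inserted); `H28_finset_sum` /
  `H28_sum_eq_sum_term214` — `H(Z, Z₀)` is additive in `Φ`, so a finite sum of such `Φ`'s (the sum over `𝐃, P`) has
  `H(Z, Z₀) = Σ_{(𝐃,P)}` (2.14).
HONEST SCOPE.  Bookkeeping only ([folklore] finite sums, Bochner linearity, the corner combinatorics), instantiated at
the printed formulas.  NOT touched: the resummation (2.4) over `Z₀` and the conditioning / change of variables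
(2.5)–(2.6) that produce `G` (rows B13.Eq2.4–2.6: `B13GaugeDevices` §H, `B2Eq228Conditioning`), the range restriction
of (2.8) ((1.10)-vanishing, `B13Sect2Statements.display_28_restricted`), the construction and analyticity of the
paper's operator families in `σ` (Sect. 1 / p. 13 by reference to [13]; here the hypothesis `SepHolOn`, as in
`B13Term214`), and the integrability of the corner terms (hypotheses `hB`, `hX`; for the printed last line under
(2.20)+(2.22) and `Re A ≻ 0` they are Gaussian-dominated, cf. `B13Replacement223` §7).  No `sorry`, no definition,
no new named fact (D-0026); display-specific statements carry the locator, plumbing is tagged "(elementary API for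
(2.xx))".

v1.1 (same unit and generation; APPEND-ONLY, v1 declarations byte-identical): §5 `display_24_pointwise` — (2.4) p. 12
pointwise in the field: for any assignment `(𝐃, P) ↦ Z₀` the integrand `χ_k·exp[Σ𝐕_k]` of (2.1) is exactly
`Σ_{Z₀} F(Z₀, B)` with `F(Z₀, B)` the sum of the `(𝐃, P)`-terms assigned to `Z₀` (fibrewise regrouping of `sum_DP_lastLine`).
-/

noncomputable section

namespace Literature.MathematicalPhysics.QuantumFieldTheory.Balaban1983to89.B13Representation214

open Complex MeasureTheory Finset Matrix
open B13MayerDecoupling (corner Dop)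
open B13Sect2Statements (H28)
open B13Term214 (cornerC DopC SepHolOn term214 core214 integrand214 cgaussMean cgaussInt cgaussNorm cgaussWeight
  F214 term214_eq_DopC)

/-! ## §1. Complex corners at real base points: `DopC` of `B13Term214` = `Dop` of `B13MayerDecoupling` -/

section Corners

variable {ι : Type*} [DecidableEq ι]

/-- The complex corner of `{0,1}^S` over a real base point is the real corner, coerced.
[cite: Balaban1988RG2Cluster, (2.8) p.14, (2.14) p.15] (elementary API for (2.14)) -/
theorem cornerC_ofReal (S T : Finset ι) (s : ι → ℝ) :
    cornerC S T (fun i => (s i : ℂ)) = fun i => ((corner S T s i : ℝ) : ℂ) := by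
  funext i
  simp only [cornerC, corner]
  split_ifs <;> simp

/-- A corner coordinate inside `S` is `1` on `T` and `0` off `T`. [cite: Balaban1988RG2Cluster, (2.14) p.15]
(elementary API for (2.14)) -/
theorem cornerC_apply_of_mem {S T : Finset ι} {i : ι} (hi : i ∈ S) (p : ι → ℂ) :
    cornerC S T p i = if i ∈ T then 1 else 0 := by
  simp [cornerC, hi]

/-- The coordinates of a corner lie in `U` when `0, 1 ∈ U` and the base point's do.
[cite: Balaban1988RG2Cluster, (2.14) p.15] (elementary API for (2.14)) -/
theorem cornerC_mem {U : Set ℂ} (h0 : (0 : ℂ) ∈ U) (h1 : (1 : ℂ) ∈ U) (S T : Finset ι) {p : ι → ℂ}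
    (hp : ∀ j, p j ∈ U) (j : ι) : cornerC S T p j ∈ U := by
  unfold cornerC
  split_ifs
  · exact h1
  · exact h0
  · exact hp j

variable {E : Type*} [NormedAddCommGroup E] [NormedSpace ℂ E]

/-- `DopC` evaluates its argument only at the corners: two functions agreeing there have the same `DopC`.
[cite: Balaban1988RG2Cluster, (2.14) p.15] (elementary API for (2.14)) -/
theorem DopC_congr {S : Finset ι} {Φ Φ' : (ι → ℂ) → E} {p : ι → ℂ}
    (h : ∀ T ∈ S.powerset, Φ (cornerC S T p) = Φ' (cornerC S T p)) : DopC S Φ p = DopC S Φ' p := by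
  simp only [DopC]
  exact Finset.sum_congr rfl fun T hT => by rw [h T hT]

/-- **The `σ`-differences of (2.14) at a real base point are the `s`-differences of (2.8)**: for a function `Φ` of
the complex parameters, `D^ℂ_S Φ (s) = D_S (s′ ↦ Φ(s′)) (s)` at every REAL `s` — `B13Term214.DopC` (corners with
complex coordinates `0, 1`) against `B13MayerDecoupling.Dop` (the σ-term of (1.9), used by `B13Sect2Statements.H28`
for (2.8)). [cite: Balaban1988RG2Cluster, (2.8) p.14, (2.14) p.15] -/
theorem DopC_ofReal (S : Finset ι) (Φ : (ι → ℂ) → E) (s : ι → ℝ) :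
    DopC S Φ (fun i => (s i : ℂ)) = Dop S (fun s' : ι → ℝ => Φ (fun i => (s' i : ℂ))) s := by
  simp only [DopC, Dop, cornerC_ofReal]
  refine Finset.sum_congr rfl fun T _ => ?_
  rw [← Int.cast_smul_eq_zsmul ℂ, Int.cast_pow, Int.cast_neg, Int.cast_one]

/-- Hence the (2.8)-summand `H(Z, Z₀) = D_{Z∖Z′₀} Φ |_{s(σ₀)=0}` (`B13Sect2Statements.H28`) of a function given on
complex parameters is the complex corner difference at the real base point `s|_{s(σ₀)=0}`.
[cite: Balaban1988RG2Cluster, (2.8) p.14, (2.14) p.15] -/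
theorem H28_eq_DopC (Z₀' σ₀ : Finset ι) (Φ : (ι → ℂ) → E) (s : ι → ℝ) (Z : Finset ι) :
    H28 Z₀' σ₀ (fun s' : ι → ℝ => Φ (fun i => (s' i : ℂ))) s Z
      = DopC (Z \ Z₀') Φ (fun i => ((corner σ₀ ∅ s i : ℝ) : ℂ)) := by
  rw [H28, DopC_ofReal]

end Corners

/-! ## §2. The last line at the `t`-corners: the `(𝐃, P)`-term of (2.1)×(2.3) -/

section LastLine

variable {κ : Type*} [DecidableEq κ]

/-- **The `𝐃`-term of the Mayer expansion (2.1) as a corner difference**: for every finite `𝐃` and values `V_Y`,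
`D^τ_{𝐃} exp[Σ_{Y∈𝐃} τ(Y)V_Y] = Σ_{T⊆𝐃} (−1)^{|𝐃∖T|} exp[Σ_{Y∈T} V_Y] = Π_{Y∈𝐃} (e^{V_Y} − 1)` — the summand of
`e^{Σ_{Y∈𝐃_k}V_Y} = Σ_{𝐃⊂𝐃_k} Π_{Y∈𝐃}(e^{V_Y} − 1)` (`B13MayerDecoupling.exp_sum_eq_sum_powerset_prod`), equal to the
printed `Π_{Y∈𝐃}∫₀¹dt(Y) e^{t(Y)V_Y}V_Y` (`B13MayerDecoupling.integral_exp_mul_eq`); the base point is immaterial.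
[cite: Balaban1988RG2Cluster, (2.1) p.12, (2.14) p.15] -/
theorem DopC_cexp_sum (S : Finset κ) (V : κ → ℂ) (p : κ → ℂ) :
    DopC S (fun τ => Complex.exp (∑ Y ∈ S, τ Y * V Y)) p = ∏ Y ∈ S, (Complex.exp (V Y) - 1) := by
  have h : ∀ Y ∈ S, Complex.exp (V Y) - 1 = Complex.exp (V Y) + (-1) := fun Y _ => sub_eq_add_neg _ _
  rw [Finset.prod_congr rfl h, Finset.prod_add]
  simp only [DopC, smul_eq_mul]
  refine Finset.sum_congr rfl fun T hT => ?_
  have hTS : T ⊆ S := Finset.mem_powerset.1 hT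
  have e : ∀ Y ∈ S, cornerC S T p Y * V Y = if Y ∈ T then V Y else 0 := by
    intro Y hY
    rw [cornerC_apply_of_mem hY]
    split_ifs <;> simp
  rw [Finset.prod_const, Finset.sum_congr rfl e, Finset.sum_ite_mem, Finset.inter_eq_right.2 hTS, Complex.exp_sum,
    mul_comm]

/-- Constants come out of a corner difference. [cite: Balaban1988RG2Cluster, (2.14) p.15] (elementary API for (2.14)) -/
theorem DopC_const_mul (S : Finset κ) (c : ℂ) (Φ : (κ → ℂ) → ℂ) (p : κ → ℂ) :
    DopC S (fun τ => c * Φ τ) p = c * DopC S Φ p := by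
  simp only [DopC, smul_eq_mul, Finset.mul_sum]
  exact Finset.sum_congr rfl fun T _ => by ring

/-- **The printed last line of (2.14) at the `t`-corners is the `(𝐃, P)`-term of (2.1)×(2.3)**: for
`F(τ, B) = (−1)^{|P|} χ_{k,Y₀}(B) χᶜ_{k,P}(B) exp[Σ_{Y∈𝐃} τ(Y)𝐕_k(Y, B)]` (`B13Term214.F214`),
`D^τ_{𝐃} F(·, B) = (−1)^{|P|} χ_{k,Y₀}(B) χᶜ_{k,P}(B) · Π_{Y∈𝐃} (e^{𝐕_k(Y,B)} − 1)`.
[cite: Balaban1988RG2Cluster, (2.1) p.12, (2.3) p.12, (2.14) p.15] -/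
theorem DopC_F214 {Λ : Type} (cardP : ℕ) (χY₀ χcP : (Λ → ℝ) → ℝ) (Dfam : Finset κ) (V : κ → (Λ → ℝ) → ℂ)
    (τ₀ : κ → ℂ) (B : Λ → ℝ) :
    DopC Dfam (fun τ => F214 cardP χY₀ χcP Dfam V τ B) τ₀
      = (-1) ^ cardP * (χY₀ B : ℂ) * (χcP B : ℂ) * ∏ Y ∈ Dfam, (Complex.exp (V Y B) - 1) := by
  rw [show (fun τ : κ → ℂ => F214 cardP χY₀ χcP Dfam V τ B)
      = fun τ => ((-1) ^ cardP * (χY₀ B : ℂ) * (χcP B : ℂ)) * Complex.exp (∑ Y ∈ Dfam, τ Y * V Y B) from rfl,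
    DopC_const_mul, DopC_cexp_sum]

omit [DecidableEq κ] in
/-- **Summed over `(𝐃, P)` the corner last lines give back the integrand of (2.1)**: with `χ_k = χ_{k,Y₀}·Π_{b∈Y₀^{c*}}
(1 − χ({|B(b)| ≧ ε₁/g_k}))` for every `𝐃` (the first equality of (2.3), `Y₀ = ∪𝐃`; here the hypothesis `h23` on
abstract values `χY 𝐃 = χ_{k,Y₀}(B)`, `χb b = χ({|B(b)| ≧ ε₁/g_k})`, bond sets `S 𝐃 = Y₀^{c*}`),
`Σ_{𝐃⊂𝐃_k} Σ_{P⊂S(𝐃)} (−1)^{|P|} χY(𝐃) Π_{b∈P}χb(b) Π_{Y∈𝐃}(e^{V_Y} − 1) = χ_k · exp[Σ_{Y∈𝐃_k} V_Y]` — (2.3)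
(`B13MayerDecoupling.prod_one_sub_eq_sum_powerset`) then (2.1) (`B13MayerDecoupling.exp_sum_eq_sum_powerset_prod`).
[cite: Balaban1988RG2Cluster, (2.1) p.12, (2.3) p.12, (2.14) p.15] -/
theorem sum_DP_lastLine {β : Type*} (𝒟 : Finset κ) (S : Finset κ → Finset β) (χk : ℂ)
    (χY : Finset κ → ℂ) (χb : β → ℂ) (V : κ → ℂ)
    (h23 : ∀ D ∈ 𝒟.powerset, χY D * ∏ b ∈ S D, (1 - χb b) = χk) :
    ∑ D ∈ 𝒟.powerset, ∑ P ∈ (S D).powerset,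
        (-1) ^ P.card * χY D * (∏ b ∈ P, χb b) * ∏ Y ∈ D, (Complex.exp (V Y) - 1)
      = χk * Complex.exp (∑ Y ∈ 𝒟, V Y) := by
  rw [B13MayerDecoupling.exp_sum_eq_sum_powerset_prod, Finset.mul_sum]
  refine Finset.sum_congr rfl fun D hD => ?_
  have h3 : ∑ P ∈ (S D).powerset, (-1) ^ P.card * χY D * (∏ b ∈ P, χb b)
      = χY D * ∏ b ∈ S D, (1 - χb b) := by
    rw [B13MayerDecoupling.prod_one_sub_eq_sum_powerset, Finset.mul_sum]
    exact Finset.sum_congr rfl fun P _ => by ring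
  rw [← Finset.sum_mul, h3, h23 D hD]

end LastLine

/-! ## §3. Exchange of the corner sums with the Gaussian integrals of (2.14) (linearity, given integrability) -/

section Exchange

variable {Λ : Type} [Fintype Λ]

/-- Finite linear combinations come out of the complex Gaussian mean `∫dμ_{A⁻¹}(B)` of (2.14), given integrability
of each term against the complex weight (`∫Σ = Σ∫`). [cite: Balaban1988RG2Cluster, (2.14) p.15] (elementary API for (2.14)) -/
theorem cgaussMean_finset_sum {α : Type*} (s : Finset α) (A : Matrix Λ Λ ℂ) (c : α → ℂ) (Ψ : α → (Λ → ℝ) → ℂ)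
    (hΨ : ∀ a ∈ s, Integrable (fun v => cgaussWeight A v * Ψ a v)) :
    cgaussMean A (fun v => ∑ a ∈ s, c a * Ψ a v) = ∑ a ∈ s, c a * cgaussMean A (Ψ a) := by
  simp only [cgaussMean, cgaussInt]
  have e : (fun v => cgaussWeight A v * ∑ a ∈ s, c a * Ψ a v)
      = fun v => ∑ a ∈ s, c a * (cgaussWeight A v * Ψ a v) := by
    funext v
    rw [Finset.mul_sum]
    exact Finset.sum_congr rfl fun a _ => by ring
  rw [e, integral_finsetSum s (fun a ha => (hΨ a ha).const_mul (c a)), Finset.mul_sum]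
  refine Finset.sum_congr rfl fun a _ => ?_
  rw [integral_const_mul]
  ring

variable [DecidableEq Λ] {C₀ : Type}

/-- Finite linear combinations in the last line come out of lines 2–3 of (2.14) (`B13Term214.integrand214 A Γ F X =
e^{−½⟨ΓX,A⁻¹ΓX⟩}∫dμ_{A⁻¹}(B) e^{−⟨B,ΓX⟩}F(B)`), given integrability of each term.
[cite: Balaban1988RG2Cluster, (2.14) p.15] (elementary API for (2.14)) -/
theorem integrand214_finset_sum {α : Type*} (s : Finset α) (A : Matrix Λ Λ ℂ) (Γ : (Λ ⊕ C₀ → ℝ) → (Λ → ℂ))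
    (c : α → ℂ) (Ψ : α → (Λ → ℝ) → ℂ) (X : Λ ⊕ C₀ → ℝ)
    (hΨ : ∀ a ∈ s, Integrable (fun B : Λ → ℝ =>
      cgaussWeight A B * (Complex.exp (-((fun i => (B i : ℂ)) ⬝ᵥ Γ X)) * Ψ a B))) :
    integrand214 A Γ (fun B => ∑ a ∈ s, c a * Ψ a B) X = ∑ a ∈ s, c a * integrand214 A Γ (Ψ a) X := by
  simp only [integrand214]
  have e : (fun B : Λ → ℝ => Complex.exp (-((fun i => (B i : ℂ)) ⬝ᵥ Γ X)) * ∑ a ∈ s, c a * Ψ a B)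
      = fun B => ∑ a ∈ s, c a * (Complex.exp (-((fun i => (B i : ℂ)) ⬝ᵥ Γ X)) * Ψ a B) := by
    funext B
    rw [Finset.mul_sum]
    exact Finset.sum_congr rfl fun a _ => by ring
  rw [e, cgaussMean_finset_sum s A c _ hΨ, Finset.mul_sum]
  exact Finset.sum_congr rfl fun a _ => by ring

variable [Fintype C₀] [DecidableEq C₀] {ι κ : Type*} [DecidableEq κ]

/-- **The `τ`-differences pass under the integrals of (2.14)**: for the `X`-integral `Ψ(σ, τ) = ∫dμ₀(X)|_Z (lines 2–4
with last line F(τ, ·))` (`B13Term214.core214 A Γ F σ τ`),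
`D^τ_{𝐃} Ψ(σ, ·) (τ₀) = ∫dμ₀(X)|_Z exp(−½⟨Γ(σ)X, A(σ)⁻¹Γ(σ)X⟩) ∫dμ_{A(σ)⁻¹}(B) e^{−⟨B,Γ(σ)X⟩} [D^τ_{𝐃}F(·, B)](τ₀)` —
the corner sum is finite, and each corner term is assumed integrable against the two (complex) Gaussian weights.
[cite: Balaban1988RG2Cluster, (2.14) p.15] -/
theorem DopC_core214 (A : (ι → ℂ) → Matrix Λ Λ ℂ) (Γ : (ι → ℂ) → (Λ ⊕ C₀ → ℝ) → (Λ → ℂ))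
    (F : (κ → ℂ) → (Λ → ℝ) → ℂ) (S : Finset κ) (σ : ι → ℂ) (τ₀ : κ → ℂ)
    (hB : ∀ T ∈ S.powerset, ∀ X : Λ ⊕ C₀ → ℝ, Integrable (fun B : Λ → ℝ =>
      cgaussWeight (A σ) B * (Complex.exp (-((fun i => (B i : ℂ)) ⬝ᵥ Γ σ X)) * F (cornerC S T τ₀) B)))
    (hX : ∀ T ∈ S.powerset, Integrable (fun X : Λ ⊕ C₀ → ℝ =>
      cgaussWeight (1 : Matrix (Λ ⊕ C₀) (Λ ⊕ C₀) ℂ) X * integrand214 (A σ) (Γ σ) (F (cornerC S T τ₀)) X)) :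
    DopC S (fun τ => core214 A Γ F σ τ) τ₀
      = cgaussMean (1 : Matrix (Λ ⊕ C₀) (Λ ⊕ C₀) ℂ)
          (fun X => integrand214 (A σ) (Γ σ) (fun B => DopC S (fun τ => F τ B) τ₀) X) := by
  simp only [DopC, core214, smul_eq_mul]
  have e : (fun X => integrand214 (A σ) (Γ σ)
        (fun B => ∑ T ∈ S.powerset, (-1 : ℂ) ^ (S \ T).card * F (cornerC S T τ₀) B) X)
      = fun X => ∑ T ∈ S.powerset, (-1 : ℂ) ^ (S \ T).card * integrand214 (A σ) (Γ σ) (F (cornerC S T τ₀)) X :=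
    funext fun X => integrand214_finset_sum S.powerset (A σ) (Γ σ) _ (fun T => F (cornerC S T τ₀)) X
      (fun T hT => hB T hT X)
  rw [e, cgaussMean_finset_sum S.powerset _ _ _ hX]

end Exchange

/-! ## §4. The representation: the `(𝐃, P)`-summand of `H(Z, Z₀)` ((2.8) with (2.1), (2.3) inserted) IS (2.14) -/

section Representation

variable {Λ : Type} [Fintype Λ] [DecidableEq Λ] {C₀ : Type} [Fintype C₀] [DecidableEq C₀]
variable {ι κ : Type*} [DecidableEq ι] [DecidableEq κ]

/-- **(2.14) is the `(𝐃, P)`-term of `H(Z, Z₀)`** (p. 15: *"To get a bound for H(Z) we consider a term in the sum over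
𝐃, P. This term can be written in the following form: (2.14)"*).  Data: operator families `A(σ) = C^{(k)}(Z₀, σ)⁻¹`,
`Γ(σ) = Γ_k(Z₀, σ)` on the complex parameters `σ(Δ)`, a `τ`-dependent last line `F(τ, B)` (for the print:
`B13Term214.F214`, whose `τ`-corner difference is the `(𝐃,P)`-term `(−1)^{|P|}χ_{k,Y₀}χᶜ_{k,P}Π_{Y∈𝐃}(e^{𝐕_k(Y,·)} − 1)`
of (2.1)×(2.3), `DopC_F214`), the `LM`-cubes `σ₀` and `Z′₀` of p. 13, a real parameter point `s`, the list `𝐃` of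
the `τ`-parameters (base point `τ₀`; print: all `t` integrated).  Hypotheses: `∫dμ₀(X)|_Z(lines 2–4)` =
`B13Term214.core214 A Γ F` is separately holomorphic in the `σ(Δ)` and in the `τ(Y)` on an open `U` containing the
closed `r`-discs about `[0, 1]` (*"We consider it as an analytic function … of the complex parameters σ(Z), τ"*; the
hypothesis of `B13Term214.term214_eq_DopC`), the base points lie in `U`, and at every parameter point in `U` the
corner terms are integrable against the two Gaussian weights (`∫Σ = Σ∫`).  CONCLUSION: the (2.8)-summand
`H(Z, Z₀) = D_{Z∖Z′₀}Φ|_{s(σ₀)=0}` (`B13Sect2Statements.H28`) of the function of the REAL parameters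
`Φ(s′) = ∫dμ₀(X)|_Z exp(−½⟨Γ(s′)X, A(s′)⁻¹Γ(s′)X⟩) ∫dμ_{A(s′)⁻¹}(B) e^{−⟨B,Γ(s′)X⟩} [D^τ_{𝐃}F(·, B)]` — lines 2–3 of
(2.14) at real parameters (= the integrand `G` of (2.6)/(2.8), `B13Term214.integrand214_real`) with the `(𝐃, P)`-term
as last line — EQUALS the display (2.14): `B13Term214.term214 r (Z∖Z′₀) 𝐃 (core214 A Γ F) (s|_{s(σ₀)=0}) τ₀`, the
printed Cauchy operators in `σ(Δ)`, `Δ ∈ Z∖Z′₀`, and `τ(Y)`, `Y ∈ 𝐃`, applied to `∫dμ₀(X)|_Z (lines 2–4)`.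
[cite: Balaban1988RG2Cluster, (2.8) p.14, (2.14) p.15] -/
theorem H28_eq_term214 {U : Set ℂ} (hU : IsOpen U) {r : ℝ} (hr : 0 < r)
    (hsub : ∀ s ∈ Set.uIcc (0 : ℝ) 1, Metric.closedBall (s : ℂ) r ⊆ U)
    (A : (ι → ℂ) → Matrix Λ Λ ℂ) (Γ : (ι → ℂ) → (Λ ⊕ C₀ → ℝ) → (Λ → ℂ)) (F : (κ → ℂ) → (Λ → ℝ) → ℂ)
    (hσ : ∀ τ : κ → ℂ, (∀ j, τ j ∈ U) → SepHolOn U (fun σ => core214 A Γ F σ τ))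
    (hτ : ∀ σ : ι → ℂ, (∀ j, σ j ∈ U) → SepHolOn U (fun τ => core214 A Γ F σ τ))
    {lD : List κ} (hlD : lD.Nodup) {τ₀ : κ → ℂ} (hτ₀ : ∀ j, τ₀ j ∈ U)
    (Z₀' σ₀ Z : Finset ι) {s : ι → ℝ} (hs : ∀ j, ((corner σ₀ ∅ s j : ℝ) : ℂ) ∈ U)
    (hB : ∀ σ : ι → ℂ, (∀ j, σ j ∈ U) → ∀ T ∈ lD.toFinset.powerset, ∀ X : Λ ⊕ C₀ → ℝ,
      Integrable (fun B : Λ → ℝ => cgaussWeight (A σ) B *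
        (Complex.exp (-((fun i => (B i : ℂ)) ⬝ᵥ Γ σ X)) * F (cornerC lD.toFinset T τ₀) B)))
    (hX : ∀ σ : ι → ℂ, (∀ j, σ j ∈ U) → ∀ T ∈ lD.toFinset.powerset, Integrable (fun X : Λ ⊕ C₀ → ℝ =>
      cgaussWeight (1 : Matrix (Λ ⊕ C₀) (Λ ⊕ C₀) ℂ) X *
        integrand214 (A σ) (Γ σ) (F (cornerC lD.toFinset T τ₀)) X)) :
    H28 Z₀' σ₀ (fun s' : ι → ℝ => cgaussMean (1 : Matrix (Λ ⊕ C₀) (Λ ⊕ C₀) ℂ)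
        (fun X => integrand214 (A fun i => (s' i : ℂ)) (Γ fun i => (s' i : ℂ))
          (fun B => DopC lD.toFinset (fun τ => F τ B) τ₀) X)) s Z
      = term214 r (Z \ Z₀').toList lD (core214 A Γ F) (fun i => ((corner σ₀ ∅ s i : ℝ) : ℂ)) τ₀ := by
  have h0 : (0 : ℂ) ∈ U := by simpa using hsub 0 (by simp) (Metric.mem_closedBall_self hr.le)
  have h1 : (1 : ℂ) ∈ U := by simpa using hsub 1 (by simp) (Metric.mem_closedBall_self hr.le)
  rw [term214_eq_DopC hU hr hsub hσ hτ (Finset.nodup_toList _) hlD hs hτ₀, Finset.toList_toFinset,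
    H28_eq_DopC Z₀' σ₀ (fun σ => cgaussMean (1 : Matrix (Λ ⊕ C₀) (Λ ⊕ C₀) ℂ)
      (fun X => integrand214 (A σ) (Γ σ) (fun B => DopC lD.toFinset (fun τ => F τ B) τ₀) X)) s Z]
  refine DopC_congr fun T _ => ?_
  have hmem : ∀ j, cornerC (Z \ Z₀') T (fun i => ((corner σ₀ ∅ s i : ℝ) : ℂ)) j ∈ U :=
    cornerC_mem h0 h1 _ _ hs
  exact (DopC_core214 A Γ F lD.toFinset _ τ₀ (hB _ hmem) (hX _ hmem)).symm

/-- **The same for the printed last line** `(−1)^{|P|}χ_{k,Y₀}(B)χᶜ_{k,P}(B)exp[Σ_{Y∈𝐃}τ(Y)𝐕_k(Y,B)]`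
(`B13Term214.F214`): the (2.8)-summand of `Φ(s′) = ∫dμ₀(X)|_Z (lines 2–3 of (2.14) at the real parameters s′) ·
[(−1)^{|P|}χ_{k,Y₀}χᶜ_{k,P} Π_{Y∈𝐃}(e^{𝐕_k(Y,·)} − 1)]` — `G` of (2.6)/(2.8) with the `(𝐃, P)`-term of (2.1)×(2.3) in
place of `χ_k exp[Σ𝐕_k]` — equals the display (2.14) verbatim (`DopC_F214` inserted in `H28_eq_term214`).
[cite: Balaban1988RG2Cluster, (2.1) p.12, (2.3) p.12, (2.8) p.14, (2.14) p.15] -/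
theorem H28_eq_term214_F214 {U : Set ℂ} (hU : IsOpen U) {r : ℝ} (hr : 0 < r)
    (hsub : ∀ s ∈ Set.uIcc (0 : ℝ) 1, Metric.closedBall (s : ℂ) r ⊆ U)
    (A : (ι → ℂ) → Matrix Λ Λ ℂ) (Γ : (ι → ℂ) → (Λ ⊕ C₀ → ℝ) → (Λ → ℂ))
    (cardP : ℕ) (χY₀ χcP : (Λ → ℝ) → ℝ) {lD : List κ} (hlD : lD.Nodup) (V : κ → (Λ → ℝ) → ℂ)
    (hσ : ∀ τ : κ → ℂ, (∀ j, τ j ∈ U) →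
      SepHolOn U (fun σ => core214 A Γ (F214 cardP χY₀ χcP lD.toFinset V) σ τ))
    (hτ : ∀ σ : ι → ℂ, (∀ j, σ j ∈ U) →
      SepHolOn U (fun τ => core214 A Γ (F214 cardP χY₀ χcP lD.toFinset V) σ τ))
    {τ₀ : κ → ℂ} (hτ₀ : ∀ j, τ₀ j ∈ U)
    (Z₀' σ₀ Z : Finset ι) {s : ι → ℝ} (hs : ∀ j, ((corner σ₀ ∅ s j : ℝ) : ℂ) ∈ U)
    (hB : ∀ σ : ι → ℂ, (∀ j, σ j ∈ U) → ∀ T ∈ lD.toFinset.powerset, ∀ X : Λ ⊕ C₀ → ℝ,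
      Integrable (fun B : Λ → ℝ => cgaussWeight (A σ) B *
        (Complex.exp (-((fun i => (B i : ℂ)) ⬝ᵥ Γ σ X))
          * F214 cardP χY₀ χcP lD.toFinset V (cornerC lD.toFinset T τ₀) B)))
    (hX : ∀ σ : ι → ℂ, (∀ j, σ j ∈ U) → ∀ T ∈ lD.toFinset.powerset, Integrable (fun X : Λ ⊕ C₀ → ℝ =>
      cgaussWeight (1 : Matrix (Λ ⊕ C₀) (Λ ⊕ C₀) ℂ) X *
        integrand214 (A σ) (Γ σ) (F214 cardP χY₀ χcP lD.toFinset V (cornerC lD.toFinset T τ₀)) X)) :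
    H28 Z₀' σ₀ (fun s' : ι → ℝ => cgaussMean (1 : Matrix (Λ ⊕ C₀) (Λ ⊕ C₀) ℂ)
        (fun X => integrand214 (A fun i => (s' i : ℂ)) (Γ fun i => (s' i : ℂ))
          (fun B => (-1) ^ cardP * (χY₀ B : ℂ) * (χcP B : ℂ) * ∏ Y ∈ lD.toFinset, (Complex.exp (V Y B) - 1)) X)) s Z
      = term214 r (Z \ Z₀').toList lD (core214 A Γ (F214 cardP χY₀ χcP lD.toFinset V))
          (fun i => ((corner σ₀ ∅ s i : ℝ) : ℂ)) τ₀ := by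
  simpa only [DopC_F214] using H28_eq_term214 hU hr hsub A Γ (F214 cardP χY₀ χcP lD.toFinset V) hσ hτ hlD hτ₀
    Z₀' σ₀ Z hs hB hX

variable {E : Type*} [AddCommGroup E]

omit [DecidableEq κ] in
/-- `H(Z, Z₀)` is additive in the function of the parameters: `D_{Z∖Z′₀}` is a finite signed sum of evaluations, so
the (2.8)-summand of a finite sum of functions `Φ_j` (the sum over `𝐃, P`) is the sum of the summands.
[cite: Balaban1988RG2Cluster, (2.8) p.14] (elementary API for (2.8)) -/
theorem H28_finset_sum {α : Type*} (J : Finset α) (Z₀' σ₀ : Finset ι) (Φ : α → (ι → ℝ) → E) (s : ι → ℝ)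
    (Z : Finset ι) : H28 Z₀' σ₀ (fun s' => ∑ j ∈ J, Φ j s') s Z = ∑ j ∈ J, H28 Z₀' σ₀ (Φ j) s Z := by
  simp only [H28, Dop, Finset.smul_sum]
  rw [Finset.sum_comm]

/-- **`H(Z, Z₀) = Σ_{(𝐃,P)}` (2.14)**: when the function of the parameters in (2.8) is the finite sum over the pairs
`j = (𝐃, P)` of the functions `Φ_j` of `H28_eq_term214` (the Mayer expansion (2.1) and the decomposition (2.3)
inserted under the integrals of `G`), its (2.8)-summand is the sum over `j` of the displays (2.14) — given, for each
`j`, the hypotheses of `H28_eq_term214`. [cite: Balaban1988RG2Cluster, (2.8) p.14, (2.14) p.15] -/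
theorem H28_sum_eq_sum_term214 {α : Type*} (J : Finset α) {U : Set ℂ} (hU : IsOpen U) {r : ℝ} (hr : 0 < r)
    (hsub : ∀ s ∈ Set.uIcc (0 : ℝ) 1, Metric.closedBall (s : ℂ) r ⊆ U)
    (A : (ι → ℂ) → Matrix Λ Λ ℂ) (Γ : (ι → ℂ) → (Λ ⊕ C₀ → ℝ) → (Λ → ℂ)) (F : α → (κ → ℂ) → (Λ → ℝ) → ℂ)
    (hσ : ∀ j ∈ J, ∀ τ : κ → ℂ, (∀ i, τ i ∈ U) → SepHolOn U (fun σ => core214 A Γ (F j) σ τ))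
    (hτ : ∀ j ∈ J, ∀ σ : ι → ℂ, (∀ i, σ i ∈ U) → SepHolOn U (fun τ => core214 A Γ (F j) σ τ))
    (lD : α → List κ) (hlD : ∀ j ∈ J, (lD j).Nodup) {τ₀ : κ → ℂ} (hτ₀ : ∀ i, τ₀ i ∈ U)
    (Z₀' σ₀ Z : Finset ι) {s : ι → ℝ} (hs : ∀ i, ((corner σ₀ ∅ s i : ℝ) : ℂ) ∈ U)
    (hB : ∀ j ∈ J, ∀ σ : ι → ℂ, (∀ i, σ i ∈ U) → ∀ T ∈ (lD j).toFinset.powerset, ∀ X : Λ ⊕ C₀ → ℝ,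
      Integrable (fun B : Λ → ℝ => cgaussWeight (A σ) B *
        (Complex.exp (-((fun i => (B i : ℂ)) ⬝ᵥ Γ σ X)) * F j (cornerC (lD j).toFinset T τ₀) B)))
    (hX : ∀ j ∈ J, ∀ σ : ι → ℂ, (∀ i, σ i ∈ U) → ∀ T ∈ (lD j).toFinset.powerset, Integrable (fun X : Λ ⊕ C₀ → ℝ =>
      cgaussWeight (1 : Matrix (Λ ⊕ C₀) (Λ ⊕ C₀) ℂ) X *
        integrand214 (A σ) (Γ σ) (F j (cornerC (lD j).toFinset T τ₀)) X)) :
    H28 Z₀' σ₀ (fun s' : ι → ℝ => ∑ j ∈ J, cgaussMean (1 : Matrix (Λ ⊕ C₀) (Λ ⊕ C₀) ℂ)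
        (fun X => integrand214 (A fun i => (s' i : ℂ)) (Γ fun i => (s' i : ℂ))
          (fun B => DopC (lD j).toFinset (fun τ => F j τ B) τ₀) X)) s Z
      = ∑ j ∈ J, term214 r (Z \ Z₀').toList (lD j) (core214 A Γ (F j))
          (fun i => ((corner σ₀ ∅ s i : ℝ) : ℂ)) τ₀ := by
  rw [H28_finset_sum]
  exact Finset.sum_congr rfl fun j hj => H28_eq_term214 hU hr hsub A Γ (F j) (hσ j hj) (hτ j hj) (hlD j hj) hτ₀
    Z₀' σ₀ Z hs (hB j hj) (hX j hj)

end Representation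

/-! ## §5 (v1.1, append-only). (2.4) p. 12 pointwise: the `(𝐃, P)`-terms regrouped by `Z₀` -/

section Resummation24

variable {κ : Type*}

/-- **(2.4) p. 12, pointwise in the field** — verbatim: *"For a given set P we take the smallest localization domain
Z₀ ∈ 𝐃_k containing Y₀ and P. … Let us consider the expression under the integral on the right-hand side of (2.1), with
a term from the expansion (2.3). We fix the domain Z₀ and we make a resummation over all terms corresponding to Z₀. This
resummation gives us a function F(Z₀, B) with the same analyticity and symmetry properties, as the function under the
integral. Thus we have `(2.1) = Σ_{Z₀∈𝐃_k} ∫dμ_{C^{(k)}}(B) F(Z₀, B).` (2.4)"*.  For ANY assignment `z(𝐃, P) = Z₀` with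
values in a finite family `Zs`, the integrand of (2.1) regroups exactly:
`χ_k·exp[Σ_{Y∈𝐃_k}V_Y] = Σ_{Z₀∈Zs} F(Z₀, B)`, `F(Z₀, B) := Σ_{(𝐃,P): z(𝐃,P) = Z₀} (−1)^{|P|}χ_{k,Y₀}χᶜ_{k,P}Π_{Y∈𝐃}(e^{V_Y} − 1)`
(`sum_DP_lastLine` + fibrewise summation); the printed (2.4) is this identity integrated against `dμ_{C^{(k)}}(B)`.
[cite: Balaban1988RG2Cluster, (2.4) p.12, (2.1) p.12, (2.3) p.12] -/
theorem display_24_pointwise {β ζ : Type*} [DecidableEq ζ] (𝒟 : Finset κ) (S : Finset κ → Finset β) (χk : ℂ)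
    (χY : Finset κ → ℂ) (χb : β → ℂ) (V : κ → ℂ)
    (h23 : ∀ D ∈ 𝒟.powerset, χY D * ∏ b ∈ S D, (1 - χb b) = χk)
    (z : (Σ _ : Finset κ, Finset β) → ζ) (Zs : Finset ζ)
    (hz : ∀ p ∈ 𝒟.powerset.sigma (fun D => (S D).powerset), z p ∈ Zs) :
    χk * Complex.exp (∑ Y ∈ 𝒟, V Y)
      = ∑ Z₀ ∈ Zs, ∑ p ∈ (𝒟.powerset.sigma fun D => (S D).powerset) with z p = Z₀,
          (-1) ^ p.2.card * χY p.1 * (∏ b ∈ p.2, χb b) * ∏ Y ∈ p.1, (Complex.exp (V Y) - 1) := by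
  rw [← sum_DP_lastLine 𝒟 S χk χY χb V h23, Finset.sum_fiberwise_of_maps_to hz, Finset.sum_sigma]

end Resummation24

end Literature.MathematicalPhysics.QuantumFieldTheory.Balaban1983to89.B13Representation214

end
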